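import Summits.QuantumFields.YangMills.Theorems.ParabolicTrajectoryLatticeGapOnTrajectoryTransferHankelSiteStrict
import Summits.QuantumFields.YangMills.Theorems.ParabolicTrajectoryLatticeGapOnTrajectoryTransferSymHelpers
import HarnessLib

/-!
# Crux `LatticeGapOnTrajectory` (stmt-QuantumFields-10523), line `orbit-kantorovich-finite-size`
# (reshape 4b): three self-contained steps of the symmetric transfer (lead c2)

Helper file (`--supports stmt-QuantumFields-10523`) for the registered stub `stub_transferSym`:

* `volume_le_two_pow_depth` — the dyadic depth `J = log₂⌊(L−1−2w)/m⌋` of the Hankel chain grows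
  linearly with the physical volume, `aL/(4t) ≤ 2^J`;
* `hankel_constant_growth` — the Hankel loss constant `C = (Kc+1)·(a⁻¹(w+1)(L+1))^p·((2B)²+1)` is
  `≥ 1` and `log C ≤ log A₁ + (4p + 2q)(log a⁻¹ + log(aL))` (polynomial in cutoff and volume);
* `norm_osCorr_cross_le_of_far` (registered helper stub) — the lattice inequality at one step: site
  RP (strict slab form) + a far sup-norm bound on the slab class ⇒ the cross bound
  `‖osCorr μ Θ₀ τ_m X Y‖ ≤ ((2(osVar X + osVar Y))^(2^J−1) K_f((B_X+B_Y)²+1))^{2^{−J}} e^{−κm}`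
  (Hankel chain `HankelSite.norm_osCorr_negReflect_le_of_decay_lt` + multiplicative polarisation
  `HankelSite.norm_osCorr_le_of_diag_bound`).

References: Osterwalder–Seiler 1978 §2; Glimm–Jaffe 1987 §6.1, §19.7; Fröhlich–Israel–Lieb–Simon 1978 §2.
-/

open scoped ComplexConjugate ComplexOrder
open Filter MeasureTheory
open Literature.MathematicalPhysics.QuantumLattice Literature.MathematicalPhysics.QuantumFieldTheory

noncomputable section

namespace Summit.QuantumFields.YangMills.Cruxes.LatticeGapOnTrajectory.OrbitKantorovichFiniteSize

namespace Transfer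

variable {G : Type} [Group G] [TopologicalSpace G] [IsTopologicalGroup G] [CompactSpace G]
  [MeasurableSpace G] [BorelSpace G]

/-! ## §1 Three self-contained steps (separate declarations keep each elaboration small) -/

section Steps

omit [TopologicalSpace G] [IsTopologicalGroup G] [CompactSpace G] [MeasurableSpace G] [BorelSpace G] in
/-- **Depth of the Hankel chain grows with the physical volume.** With `a m = t`, `a w ≤ h₁`,
`m + 2w ≤ L − 1`, `a ≤ 1` and `4h₁ + 2t + 2 ≤ aL`, the dyadic depth `J = log₂⌊(L−1−2w)/m⌋` has
`aL/(4t) ≤ 2^J`. [folklore] -/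
theorem volume_le_two_pow_depth {L w m : ℕ} {a t h₁ : ℝ} (ha : 0 < a) (ha1 : a ≤ 1) (ht : 0 < t)
    (hm : 0 < m) (ham : a * (m : ℝ) = t) (hw : a * (w : ℝ) ≤ h₁) (hfit : m + 2 * w ≤ L - 1)
    (hL1 : 1 ≤ L) (hbig : 4 * h₁ + 2 * t + 2 ≤ a * L) :
    a * L / (4 * t) ≤ (2 : ℝ) ^ Nat.log 2 ((L - 1 - 2 * w) / m) := by
  have hwin := (SymHelpers.pow_log_window hm hfit).2
  have hmR : (0 : ℝ) < m := by exact_mod_cast hm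
  have hL1R : ((L - 1 : ℕ) : ℝ) = (L : ℝ) - 1 := by
    rw [Nat.cast_sub hL1]; simp
  rw [hL1R] at hwin
  rw [div_le_iff₀ (by linarith only [ht] : (0 : ℝ) < 4 * t)]
  set X : ℝ := (2 : ℝ) ^ Nat.log 2 ((L - 1 - 2 * w) / m) with hX
  have hA : ((L : ℝ) - 1 - 2 * w) < (2 * X + 1) * m := (div_lt_iff₀ hmR).1 hwin
  have hA' : a * ((L : ℝ) - 1 - 2 * w) < a * ((2 * X + 1) * m) := mul_lt_mul_of_pos_left hA ha
  have hamX : a * ((2 * X + 1) * m) = (2 * X + 1) * t := by rw [← ham]; ring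
  rw [hamX] at hA'
  linarith [hA', hw, hbig, ha1, ha.le]

omit [TopologicalSpace G] [IsTopologicalGroup G] [CompactSpace G] [MeasurableSpace G] [BorelSpace G] in
/-- **The Hankel loss constant is polynomial in the cutoff and the physical volume.** For the
cluster-expansion constant `P = (a⁻¹ (w+1)(L+1))^p`, sup bound `KFG·a^{−q}` of each representative and
`w ≤ hi₀/a + 1 + R`, `a ≤ 1`, `L ≥ 1`, `aL ≥ 1`: the constant
`C = (Kc+1) · P · ((2 KFG a^{−q})² + 1)` satisfies `1 ≤ C` and
`log C ≤ log A₁ + (3p + 2q + p)(log a⁻¹ + log (aL))` with `A₁ = (Kc+1)(2(hi₀+2+R))^p (4KFG²+1)`.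
[folklore] -/
theorem hankel_constant_growth {a hi₀ Rr Kc KFG : ℝ} {L w p q : ℕ} (hKc : 0 ≤ Kc) (hhi : 0 ≤ hi₀)
    (hR : 0 ≤ Rr) (ha : 0 < a) (ha1 : a ≤ 1) (hL1 : 1 ≤ L) (hu1 : 1 ≤ a * L)
    (hw2 : (w : ℝ) ≤ hi₀ / a + 1 + Rr) :
    1 ≤ (Kc + 1) * (a⁻¹ * ((w : ℝ) + 1) * ((L : ℝ) + 1)) ^ p *
        ((KFG * a⁻¹ ^ q + KFG * a⁻¹ ^ q) ^ 2 + 1) ∧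
      Real.log ((Kc + 1) * (a⁻¹ * ((w : ℝ) + 1) * ((L : ℝ) + 1)) ^ p *
          ((KFG * a⁻¹ ^ q + KFG * a⁻¹ ^ q) ^ 2 + 1)) ≤
        Real.log ((Kc + 1) * (2 * (hi₀ + 2 + Rr)) ^ p * (4 * KFG ^ 2 + 1)) +
          (((3 * p + 2 * q : ℕ) : ℝ) + (p : ℝ)) * (Real.log a⁻¹ + Real.log (a * L)) := by
  have hai : 1 ≤ a⁻¹ := (one_le_inv₀ ha).2 ha1
  have hL1R : (1 : ℝ) ≤ L := by exact_mod_cast hL1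
  have hw1 : (1 : ℝ) ≤ (w : ℝ) + 1 := by
    have := (Nat.cast_nonneg w : (0 : ℝ) ≤ _); linarith only [this]
  -- lower bound
  have hbase1 : 1 ≤ a⁻¹ * ((w : ℝ) + 1) * ((L : ℝ) + 1) := by
    have h1 : (1 : ℝ) ≤ a⁻¹ * ((w : ℝ) + 1) := one_le_mul_of_one_le_of_one_le hai hw1
    exact one_le_mul_of_one_le_of_one_le h1 (by linarith only [hL1R])
  have hP1 : 1 ≤ (a⁻¹ * ((w : ℝ) + 1) * ((L : ℝ) + 1)) ^ p := one_le_pow₀ hbase1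
  have hKc1 : 0 ≤ Kc + 1 := by linarith only [hKc]
  have hC1 : 1 ≤ (Kc + 1) * (a⁻¹ * ((w : ℝ) + 1) * ((L : ℝ) + 1)) ^ p *
      ((KFG * a⁻¹ ^ q + KFG * a⁻¹ ^ q) ^ 2 + 1) := by
    have h1 : 1 ≤ (Kc + 1) * (a⁻¹ * ((w : ℝ) + 1) * ((L : ℝ) + 1)) ^ p :=
      one_le_mul_of_one_le_of_one_le (le_add_of_nonneg_left hKc) hP1
    exact one_le_mul_of_one_le_of_one_le h1 (le_add_of_nonneg_left (sq_nonneg _))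
  refine ⟨hC1, ?_⟩
  -- upper bound on the base of `P`
  have hwub : (w : ℝ) + 1 ≤ (hi₀ + 2 + Rr) * a⁻¹ := by
    have h1 : (w : ℝ) + 1 ≤ hi₀ / a + 2 + Rr := by linarith only [hw2]
    have h2 : (2 + Rr : ℝ) ≤ (2 + Rr) * a⁻¹ := le_mul_of_one_le_right (by linarith only [hR]) hai
    calc (w : ℝ) + 1 ≤ hi₀ / a + 2 + Rr := h1
      _ ≤ hi₀ * a⁻¹ + (2 + Rr) * a⁻¹ := by rw [div_eq_mul_inv]; linarith only [h2]
      _ = (hi₀ + 2 + Rr) * a⁻¹ := by ring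
  have hLub : (L : ℝ) + 1 ≤ 2 * (a * L) * a⁻¹ := by
    rw [show 2 * (a * L) * a⁻¹ = 2 * L by field_simp]
    linarith only [hL1R]
  have h2R : 0 ≤ hi₀ + 2 + Rr := by linarith only [hhi, hR]
  have hbase : a⁻¹ * ((w : ℝ) + 1) * ((L : ℝ) + 1) ≤ 2 * (hi₀ + 2 + Rr) * a⁻¹ ^ 3 * (a * L) := by
    have hinv0 : 0 ≤ a⁻¹ := inv_nonneg.2 ha.le
    calc a⁻¹ * ((w : ℝ) + 1) * ((L : ℝ) + 1)
        ≤ a⁻¹ * ((hi₀ + 2 + Rr) * a⁻¹) * (2 * (a * L) * a⁻¹) :=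
          mul_le_mul (mul_le_mul_of_nonneg_left hwub hinv0) hLub (by linarith only [hL1R])
            (mul_nonneg hinv0 (mul_nonneg h2R hinv0))
      _ = 2 * (hi₀ + 2 + Rr) * a⁻¹ ^ 3 * (a * L) := by ring
  have hPub : (a⁻¹ * ((w : ℝ) + 1) * ((L : ℝ) + 1)) ^ p ≤
      (2 * (hi₀ + 2 + Rr)) ^ p * a⁻¹ ^ (3 * p) * (a * L) ^ p := by
    calc (a⁻¹ * ((w : ℝ) + 1) * ((L : ℝ) + 1)) ^ p
        ≤ (2 * (hi₀ + 2 + Rr) * a⁻¹ ^ 3 * (a * L)) ^ p :=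
          pow_le_pow_left₀ (le_trans zero_le_one hbase1) hbase p
      _ = (2 * (hi₀ + 2 + Rr)) ^ p * a⁻¹ ^ (3 * p) * (a * L) ^ p := by
          rw [mul_pow, mul_pow, ← pow_mul]
  have hq1 : 1 ≤ a⁻¹ ^ (2 * q) := one_le_pow₀ hai
  have hBub : (KFG * a⁻¹ ^ q + KFG * a⁻¹ ^ q) ^ 2 + 1 ≤ (4 * KFG ^ 2 + 1) * a⁻¹ ^ (2 * q) := by
    have hsq : (KFG * a⁻¹ ^ q + KFG * a⁻¹ ^ q) ^ 2 = 4 * KFG ^ 2 * a⁻¹ ^ (2 * q) := by ring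
    rw [hsq]
    linarith only [hq1]
  have hstep : (Kc + 1) * (a⁻¹ * ((w : ℝ) + 1) * ((L : ℝ) + 1)) ^ p ≤
      (Kc + 1) * ((2 * (hi₀ + 2 + Rr)) ^ p * a⁻¹ ^ (3 * p) * (a * L) ^ p) :=
    mul_le_mul_of_nonneg_left hPub hKc1
  have haL0 : 0 ≤ a * L := by linarith only [hu1]
  have hbig0 : 0 ≤ (Kc + 1) * ((2 * (hi₀ + 2 + Rr)) ^ p * a⁻¹ ^ (3 * p) * (a * L) ^ p) :=
    mul_nonneg hKc1 (mul_nonneg (mul_nonneg (pow_nonneg (by linarith only [h2R]) p)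
      (pow_nonneg (inv_nonneg.2 ha.le) _)) (pow_nonneg haL0 p))
  have hB2 : 0 ≤ (KFG * a⁻¹ ^ q + KFG * a⁻¹ ^ q) ^ 2 + 1 := add_nonneg (sq_nonneg _) zero_le_one
  have hCk : (Kc + 1) * (a⁻¹ * ((w : ℝ) + 1) * ((L : ℝ) + 1)) ^ p *
      ((KFG * a⁻¹ ^ q + KFG * a⁻¹ ^ q) ^ 2 + 1) ≤
      ((Kc + 1) * (2 * (hi₀ + 2 + Rr)) ^ p * (4 * KFG ^ 2 + 1)) * a⁻¹ ^ (3 * p + 2 * q) * (a * L) ^ p :=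
    calc _ ≤ (Kc + 1) * ((2 * (hi₀ + 2 + Rr)) ^ p * a⁻¹ ^ (3 * p) * (a * L) ^ p) *
          ((4 * KFG ^ 2 + 1) * a⁻¹ ^ (2 * q)) := mul_le_mul hstep hBub hB2 hbig0
      _ = _ := by rw [pow_add]; ring
  -- logarithms
  have hA₁pos : 0 < (Kc + 1) * (2 * (hi₀ + 2 + Rr)) ^ p * (4 * KFG ^ 2 + 1) := by
    have h1 : 0 < Kc + 1 := by linarith only [hKc]
    have h2 : 0 < (2 * (hi₀ + 2 + Rr)) ^ p := pow_pos (by linarith only [hhi, hR]) p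
    have h3 : 0 < 4 * KFG ^ 2 + 1 := by linarith only [sq_nonneg KFG]
    exact mul_pos (mul_pos h1 h2) h3
  have hu0 : 0 < a * L := by linarith only [hu1]
  have hx0 : 0 < a⁻¹ ^ (3 * p + 2 * q) := pow_pos (inv_pos.2 ha) _
  have hy0 : 0 < (a * L) ^ p := pow_pos hu0 p
  have hC0 : 0 < (Kc + 1) * (a⁻¹ * ((w : ℝ) + 1) * ((L : ℝ) + 1)) ^ p *
      ((KFG * a⁻¹ ^ q + KFG * a⁻¹ ^ q) ^ 2 + 1) := lt_of_lt_of_le zero_lt_one hC1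
  have h1 := Real.log_le_log hC0 hCk
  rw [Real.log_mul (mul_pos hA₁pos hx0).ne' hy0.ne', Real.log_mul hA₁pos.ne' hx0.ne',
    Real.log_pow, Real.log_pow] at h1
  have hl0 : 0 ≤ Real.log a⁻¹ := Real.log_nonneg hai
  have hlogu : 0 ≤ Real.log (a * L) := Real.log_nonneg hu1
  have hp0 : (0 : ℝ) ≤ p := Nat.cast_nonneg p
  have he0 : (0 : ℝ) ≤ ((3 * p + 2 * q : ℕ) : ℝ) := Nat.cast_nonneg _
  have hx1 := mul_nonneg he0 hlogu
  have hx2 := mul_nonneg hp0 hl0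
  linarith only [h1, hx1, hx2]

/-- **The lattice inequality at one step: Hankel chain + multiplicative polarisation.** On the
odd torus of side `2S+1` with site RP (strict slab form) and a far bound
`‖osCorr μ Θ₀ τ_(2^J m) Z Z‖ ≤ K_f (B_Z² + 1) e^{−κ 2^J m}` for every bounded measurable `Z` of the
slab `1 … w` (`2^J m + w < S`), two such observables `X, Y` with sup bounds `B_X, B_Y` satisfy
`‖osCorr μ Θ₀ τ_m X Y‖ ≤ ((2(osVar X + osVar Y))^(2^J−1) · K_f ((B_X+B_Y)²+1))^{2^{−J}} e^{−κ m}`.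
[cite: GlimmJaffe1987, §6.1 and §19.7] [cite: FrohlichIsraelLiebSimon1978, §2] -/
theorem norm_osCorr_cross_le_of_far {N : ℕ} (ρ : G →* Matrix (Fin N) (Fin N) ℂ) (hρ : Continuous ρ)
    (β : ℝ) {S : ℕ}
    (hRP : ∀ (F : GaugeConfig 4 (2 * S + 1) G → ℂ), Measurable F → (∃ C : ℝ, ∀ U, ‖F U‖ ≤ C) →
      ∀ {w : ℕ}, w < S → DependsOn F {e : Edge 4 (2 * S + 1) | 1 ≤ (e.1 0).val ∧ (e.1 0).val ≤ w} →
        0 ≤ wilsonExpectation ρ β fun U => conj (F U.negReflect) * F U)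
    {w J m : ℕ} (hJm : 2 ^ J * m + w < S) {Kf κ : ℝ} (hKf : 0 ≤ Kf)
    (hfar : ∀ (Z : GaugeConfig 4 (2 * S + 1) G → ℂ) (B : ℝ), Measurable Z → (∀ U, ‖Z U‖ ≤ B) →
      DependsOn Z {e : Edge 4 (2 * S + 1) | 1 ≤ (e.1 0).val ∧ (e.1 0).val ≤ w} →
        ‖osCorr (wilsonMeasure (d := 4) (L := 2 * S + 1) ρ β) GaugeConfig.negReflect
            (torusTimeShift (2 * S + 1) (2 ^ J * m)) Z Z‖ ≤
          Kf * (B ^ 2 + 1) * Real.exp (-(κ * (2 ^ J * m))))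
    {X Y : GaugeConfig 4 (2 * S + 1) G → ℂ} (hX : Measurable X) (hY : Measurable Y) {BX BY : ℝ}
    (hBX0 : 0 ≤ BX) (hBY0 : 0 ≤ BY) (hBX : ∀ U, ‖X U‖ ≤ BX) (hBY : ∀ U, ‖Y U‖ ≤ BY)
    (hXd : DependsOn X {e : Edge 4 (2 * S + 1) | 1 ≤ (e.1 0).val ∧ (e.1 0).val ≤ w})
    (hYd : DependsOn Y {e : Edge 4 (2 * S + 1) | 1 ≤ (e.1 0).val ∧ (e.1 0).val ≤ w}) :
    ‖osCorr (wilsonMeasure (d := 4) (L := 2 * S + 1) ρ β) GaugeConfig.negReflect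
        (torusTimeShift (2 * S + 1) m) X Y‖ ≤
      ((2 * (osVar (wilsonMeasure (d := 4) (L := 2 * S + 1) ρ β) GaugeConfig.negReflect X +
            osVar (wilsonMeasure (d := 4) (L := 2 * S + 1) ρ β) GaugeConfig.negReflect Y)) ^ (2 ^ J - 1) *
          (Kf * ((BX + BY) ^ 2 + 1))) ^ ((2 ^ J : ℝ)⁻¹) * Real.exp (-(κ * m)) := by
  set μ := wilsonMeasure (d := 4) (L := 2 * S + 1) (G := G) ρ β with hμ
  haveI := isProbabilityMeasure_wilsonMeasure (d := 4) (L := 2 * S + 1) ρ hρ β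
  have hwS : w < S := by have := Nat.zero_le (2 ^ J * m); omega
  -- the good class
  set Good : (GaugeConfig 4 (2 * S + 1) G → ℂ) → Prop := fun Z => Measurable Z ∧ (∃ B, ∀ U, ‖Z U‖ ≤ B) ∧
    DependsOn Z {e : Edge 4 (2 * S + 1) | 1 ≤ (e.1 0).val ∧ (e.1 0).val ≤ w} with hGood
  have hmeas : ∀ Z, Good Z → Measurable Z := fun Z h => h.1
  have hadd : ∀ Z Y' (c : ℂ), Good Z → Good Y' → Good (Z + c • Y') := by
    rintro Z Y' c ⟨hZm, ⟨BZ, hBZ⟩, hZd⟩ ⟨hYm, ⟨BY', hBY'⟩, hYd'⟩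
    refine ⟨hZm.add (hYm.const_smul c), ⟨BZ + ‖c‖ * BY', fun U => ?_⟩, fun U V h => ?_⟩
    · rw [Pi.add_apply, Pi.smul_apply, smul_eq_mul]
      refine (norm_add_le _ _).trans (add_le_add (hBZ U) ?_)
      rw [norm_mul]
      exact mul_le_mul_of_nonneg_left (hBY' U) (norm_nonneg _)
    · simp only [Pi.add_apply, Pi.smul_apply, smul_eq_mul]
      rw [hZd h, hYd' h]
  have hvar : ∀ Z, Good Z → 0 ≤ osVar μ GaugeConfig.negReflect Z := fun Z h =>
    HankelSite.osVar_negReflect_nonneg_of_rp_lt ρ hρ β hRP h.1 h.2.1 hwS h.2.2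
  -- diagonal Hankel bound
  have hdiag : ∀ Z (B : ℝ), Good Z → (∀ U, ‖Z U‖ ≤ B) →
      ‖osCorr μ GaugeConfig.negReflect (torusTimeShift (2 * S + 1) m) Z Z‖ ≤
        (osVar μ GaugeConfig.negReflect Z ^ (2 ^ J - 1) * (Kf * (B ^ 2 + 1))) ^ ((2 ^ J : ℝ)⁻¹) *
          Real.exp (-(κ * m)) := fun Z B hZ hB =>
    HankelSite.norm_osCorr_negReflect_le_of_decay_lt ρ hρ β hRP hZ.1 hZ.2.1 hZ.2.2 hJm
      (hfar Z B hZ.1 hB hZ.2.2)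
  -- monotonicity of the bound and polarisation
  have hΦ : ∀ v v' b b' : ℝ, 0 ≤ v → v ≤ v' → 0 ≤ b → b ≤ b' →
      (v ^ (2 ^ J - 1) * (Kf * (b ^ 2 + 1))) ^ ((2 ^ J : ℝ)⁻¹) * Real.exp (-(κ * m)) ≤
        (v' ^ (2 ^ J - 1) * (Kf * (b' ^ 2 + 1))) ^ ((2 ^ J : ℝ)⁻¹) * Real.exp (-(κ * m)) := by
    intro v v' b b' hv hvv hb hbb
    refine mul_le_mul_of_nonneg_right ?_ (Real.exp_pos _).le
    have h := SymHelpers.rpow_prefactor_mono hKf (2 ^ J) hv hvv hb hbb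
    push_cast at h
    exact h
  exact HankelSite.norm_osCorr_le_of_diag_bound (μ := μ) (Θ := GaugeConfig.negReflect)
    (τ := ⇑(torusTimeShift (G := G) (2 * S + 1) m)) WilsonSiteRP.measurable_negReflect
    (torusTimeShift _ _).measurable hmeas hadd hvar
    (Φ := fun v b => (v ^ (2 ^ J - 1) * (Kf * (b ^ 2 + 1))) ^ ((2 ^ J : ℝ)⁻¹) * Real.exp (-(κ * m)))
    hΦ hdiag ⟨hX, ⟨BX, hBX⟩, hXd⟩ ⟨hY, ⟨BY, hBY⟩, hYd⟩ hBX0 hBY0 hBX hBY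

end Steps

end Transfer

end Summit.QuantumFields.YangMills.Cruxes.LatticeGapOnTrajectory.OrbitKantorovichFiniteSize

end
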